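import Summits.QuantumFields.YangMills.Theorems.BalabanUVNodesK0Stub1SocketFlatAtRecord
import Summits.QuantumFields.YangMills.Theorems.BalabanUVNodesK0Stub1SectFWSlotAtRecordFlatScaledExistsHerm0
import Summits.QuantumFields.YangMills.Theorems.BalabanUVNodesK0Stub1FlatHRescaledRowsAtRecord
import HarnessLib

/-!
# K0⁷ STUB 1 (`stub_prop8StepCoP13` ∕ V20-G `stub_prop8StepCoPG13`), sub-target S4b — **A6 ∕ END-TO-END ON THE ♭ ROAD: SECT. F's CURRENT `W` AT INSTANCE (S) EXISTS AT EVERY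
# ADMISSIBLE FAMILY OF THE RECORD's FOUR-TORI WITH THE (98)-SLOT, THE REALITY OF THE CHART, AND THE ♭ (127) SOCKET `⟪δX, Δ_1X₁⟫ + Re BE(W A′₁)(δ) = 0` — CONSTANTS BEFORE
# THE FAMILY, NO LETTER HYPOTHESIS** (D‴ `…SectFWSlotAtRecordFlatScaledExistsHerm0` ∧ `…K0Stub1SocketFlatAtRecord.socket127_flat_of_letters`, with dag-k0-s1-w4's row of `H♭`
# (`rescaledRows_of_adm22_T4`) and dag-k0-s1-w1's radius budgets discharged by shrinking `ε`)

Cell `pub-ymgap`, width seat `pub-ymgap-k0-s1-w2` g6 (CLAIM-3).  `--kind proof --supports stmt-QuantumFields-20541 --as helper`; count-neutral; def-free.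
[15] = [Balaban1985Variational]; [B7] = [Balaban1985Averaging]; [B6] = [Balaban1984PropagatorsII]; [III] = [Balaban1988Convergent].

WHY.  `socket127_flat_of_letters` (companion file) proves the ♭ (127) at one family from letters BY SHAPE; D‴ inhabits every letter at every admissible family of the record
with constants quantified BEFORE the family; the one extra letter (the sup row `B♭` of `H♭`) is dag-k0-s1-w4's `rescaledRows_of_adm22_T4`, and dag-k0-s1-w1's transfer needs
its radius `R` with `60800ℓ²LR ≤ 1`, `60ℓ²LR < δ_N` — functions of `L` and `N` only.  THIS FILE is the A6 inhabitant: D‴'s conclusion VERBATIM (on a possibly smaller `ε`)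
∧ the socket conjunct, so that ONE `obtain` serves Sect. F's current, its (158) row, its (157) certificate, the reality of the chart AND the (127) identity it satisfies.

WHAT IS PROVED (sorry-free; no definition; axioms standard).
* ★★★★ `exists_sectF_W_flatScaled_atRecord_socket` — for every `F : T4Family`, `N ≥ 1`: `∃ Mh₀ R₀ ε C₄`, `0 < ε`, `0 ≤ C₄`, and at every admissible nested family of the
  record's four-tori in the standing range with its (152) weights: the objects of D‴ (`τ = ntr`, `ρ`, `BE`, `B`, `M♭`, `H♭`, `Dsel♭` with (55)♭ ∕ `ContDiffOn ℂ ω` ∕ (49)♭ ∕ (48)♭ ∕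
  reality, `Qt Ht Dt`, `e`, `W` with (157)'s `HasFDerivAt`, `DifferentiableOn`, the (158)∕(98) row) **∧ for every Hermitian-traceless `A′₁` in the two-size `ε`-window, every
  Hermitian-traceless `δ` with `Qlin♭δ = 0`, every determining set `𝔹` on (2.3) index bonds of levels `≤ K − n`, every `SU(N)` reading `U₁` of `e^{iη(A′₁ − H♭Dsel♭A′₁)}` that
  is critical on the record's fibre (`Node00.IsCritOnFibre F N K 𝔹 (avgFamily (avOfRecord F N K) U₁) U₁`), and tangent letters `⇑X₁ = iη•A′₁`, `⇑δX = iη•δ`: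
  `⟪δX, Δ_1X₁⟫ + Re BE(W A′₁)(δ) = 0`**.
HONEST SCOPE.  Non-vacuity ∕ `exact` assembly; NO estimate of [15]; the CRITICALITY of the charted configuration is the displayed in-edge (K0 road §0–§3: minimiser ⇒
critical on the fibre, transported to the Landau∕axial copy — dag-k0-s1-w1 `isCritOnFibre_gaugeAct_avgFamily_iff`, modules 35∕37); the kernel is PRINT's straight kernel
`Qlin♭δ = 0` (record-kernel dictionary modulo pure gauges: dag-k0-s1-w1 `…FlatAveragingDictionaryLevels`); the `K_V`-currency of `h128` is one `exact` away (p624107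
`socket_curlCurlExt_iff_socket_hessOpAt_inner`, not restated); `stub_prop8StepCoP13` ∕ `stub_prop8StepCoPG13` ∕ K0⁷ NOT closed; N07 NOT discharged; no summit statement is proved
by this seat; counts unmoved (28∕28 · 5∕27); one finite 𝕋⁴ programme at fixed ε — R4 closes the conditional finite-𝕋⁴ rung `BalabanLadder.UV` only, never the summit; the YM mass
gap (Clay) is NOT proved by any of this; nothing continuum ∕ ℝ⁴ ∕ OS.  No `sorry`, no `def`, no `instance`, no `notation`.

References: [15] (20)–(22) p.281, (27) p.282, (44)–(50) p.285, (55) p.286, (72)–(73) p.289, (80) p.290, Prop. 4 (97)–(98) pp.292–293, (127)–(128) p.297, (152) p.301,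
(156)–(158) p.302; [B7] (17) p.21, (92) p.31, Prop. 4 (134)–(135) p.38, Prop. 5 (157) p.42; [B6] (2.3) p.224, (2.35) p.228, Cor. 2.8 p.249; [III] (2.10)–(2.12) p.256;
[Balaban1987RG1] (0.1) p.251, (0.4) p.253.
-/

set_option autoImplicit false

noncomputable section

open scoped BigOperators Matrix InnerProductSpace RealInnerProductSpace Matrix.Norms.L2Operator Topology ContDiff

namespace Summit.QuantumFields.YangMills.Theorems.K0Stub1SocketFlatAtRecordExists

open Literature.MathematicalPhysics.QuantumFieldTheory.Balaban1983to89
open Literature.MathematicalPhysics.QuantumFieldTheory.Balaban1983to89.Node00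
open T4Continuum (T4Family)
open ExpMeanLog (deltaSU deltaSU_pos)
open T4AdjointCovarianceUnitary (lieSU)
open B9AdOrthogonal (herm0)
open B9Eq39Adjoint (bondPair)
open B15DeterminingSets (bondsOf DetSet avgFamily)
open B6SectADomainsV1 (Domains)
open B6SectAOperatorsV1 (BondIdx aE)
open B6SectAVectorModelV1 (EE)
open B11Eq26ActionExpansion (V0)
open B4Sect5Torus (TSite)
open MatrixNorms (ntr)
open Summit.QuantumFields.YangMills.Theorems.FlatCubeOpsText (Adm22)
open Summit.QuantumFields.YangMills.Theorems.K0FlatCubeOpsTextP (IsLevWeight flatH)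
open Summit.QuantumFields.YangMills.Theorems.Prop8Chart (expCfg collar_of_adm22)
open Summit.QuantumFields.YangMills.Theorems.Prop8ChartDoubleBar (chartLogFlat)
open Summit.QuantumFields.YangMills.Theorems.K0Stub1SectFWSlotAtRecordFlatScaledExistsHerm0 (exists_sectF_W_flatScaled_atRecord_herm0)
open Summit.QuantumFields.YangMills.Theorems.K0Stub1FlatHRescaledRowsAtRecord (rescaledRows_of_adm22_T4)
open Summit.QuantumFields.YangMills.Theorems.K0Stub1SocketFlatAtRecord (socket127_flat_of_letters)

/-- ★★★★ **SECT. F's ♭ CURRENT AT THE RECORD WITH THE (98)-SLOT, THE REALITY OF THE CHART AND THE ♭ (127) SOCKET — NO LETTER HYPOTHESIS** (see the module docstring).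
[cite: Balaban1985Variational, (27) p.282, (44)-(50) p.285, (55) p.286, (80) p.290, (127)-(128) p.297, (152) p.301, (157)-(158) p.302; Balaban1985Averaging, (92) p.31, Prop. 4 (134)-(135) p.38, Prop. 5 (157) p.42; Balaban1984PropagatorsII, (2.35) p.228, Cor. 2.8 p.249; Balaban1988Convergent, (2.10)-(2.12) p.256; Balaban1987RG1, (0.1) p.251, (0.4) p.253] -/
theorem exists_sectF_W_flatScaled_atRecord_socket (N : ℕ) [NeZero N] (F : T4Family) :
    ∃ (Mh₀ R₀ : ℕ) (ε C₄ : ℝ), 0 < ε ∧ 0 ≤ C₄ ∧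
    ∀ (n K : ℕ) (_ : 1 ≤ K - n) (_ : K - n + 1 ≤ F.m + K) {Mh R a' : ℕ} (_ : Mh = F.L ^ a') (_ : Mh₀ ≤ Mh) (_ : R₀ ≤ R)
      (_ : a' + 3 ≤ F.m + n) (D : Domains (F.P K)) (_ : D.k = K - n) (_ : Adm22 D R (F.L * Mh))
      {w : ℕ → PBond (F.P K) 0 → ℝ} (_ : IsLevWeight (F.P K) (K - n) D w),
    ∃ (τ : Matrix (Fin N) (Fin N) ℂ →L[ℂ] ℂ) (ρ : (Matrix (Fin N) (Fin N) ℂ →L[ℂ] ℂ) →L[ℂ] Matrix (Fin N) (Fin N) ℂ)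
      (BE : (PBond (F.P K) 0 → Matrix (Fin N) (Fin N) ℂ) →L[ℂ] (PBond (F.P K) 0 → Matrix (Fin N) (Fin N) ℂ) →L[ℂ] ℂ)
      (B : (BondIdx D → Matrix (Fin N) (Fin N) ℂ) →L[ℂ] (BondIdx D → Matrix (Fin N) (Fin N) ℂ) →L[ℂ] ℂ)
      (hc : ((F.P K).L : ℝ) ^ (K - n) ≠ 0) (hwa : ∀ _i : BondIdx D, (0 : ℝ) < 1)
      (MV : (BondIdx D → Matrix (Fin N) (Fin N) ℂ) →L[ℂ] (BondIdx D → Matrix (Fin N) (Fin N) ℂ))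
      (H : (BondIdx D → Matrix (Fin N) (Fin N) ℂ) →ₗ[ℂ] (PBond (F.P K) 0 → Matrix (Fin N) (Fin N) ℂ))
      (Dsel : (PBond (F.P K) 0 → Matrix (Fin N) (Fin N) ℂ) → (BondIdx D → Matrix (Fin N) (Fin N) ℂ))
      (Qt : (BondIdx D → Matrix (Fin N) (Fin N) ℂ) →L[ℂ] (PBond (F.P K) 0 → Matrix (Fin N) (Fin N) ℂ))
      (Ht : (PBond (F.P K) 0 → Matrix (Fin N) (Fin N) ℂ) →L[ℂ] (BondIdx D → Matrix (Fin N) (Fin N) ℂ))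
      (Dt : (PBond (F.P K) 0 → Matrix (Fin N) (Fin N) ℂ) → ((BondIdx D → Matrix (Fin N) (Fin N) ℂ) →L[ℂ] (PBond (F.P K) 0 → Matrix (Fin N) (Fin N) ℂ)))
      (e : Site (F.P K) 0 ≃ TSite (F.P K).d (fun _ => (F.P K).sitesPerDir 0))
      (W : (PBond (F.P K) 0 → Matrix (Fin N) (Fin N) ℂ) → (PBond (F.P K) 0 → Matrix (Fin N) (Fin N) ℂ)),
      -- the objects of record
      (∀ X, τ X = ntr X) ∧ (∀ (ℓ' : Matrix (Fin N) (Fin N) ℂ →L[ℂ] ℂ) (X : Matrix (Fin N) (Fin N) ℂ), τ (ρ ℓ' * X) = ℓ' X) ∧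
      (∀ Y δ : PBond (F.P K) 0 → Matrix (Fin N) (Fin N) ℂ, BE Y δ =
        bondPair ((((F.P K).L : ℝ))⁻¹ ^ (K - n)) (F.P K).d (τ : Matrix (Fin N) (Fin N) ℂ →ₗ[ℂ] ℂ) (fun μ x => Y ⟨x, μ⟩) (fun μ x => δ ⟨x, μ⟩)) ∧
      (∀ X X' : BondIdx D → Matrix (Fin N) (Fin N) ℂ, B X X' = ∑ t, τ (X t * X' t)) ∧
      (∀ (X : BondIdx D → Matrix (Fin N) (Fin N) ℂ) (t : BondIdx D),
        MV X t = ∑ s, (((((F.P K).L : ℝ) ^ (t.1.1 : ℕ) * ((((F.P K).L : ℝ))⁻¹) ^ (K - n))⁻¹ *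
          WithLp.ofLp ((EE D hc hwa - aE D (fun _ => (1 : ℝ))) (WithLp.toLp 2 (Pi.single s 1))) t *
          (((F.P K).L : ℝ) ^ (s.1.1 : ℕ) * ((((F.P K).L : ℝ))⁻¹) ^ (K - n))⁻¹ : ℝ) : ℂ) • X s) ∧
      (∀ (X : BondIdx D → Matrix (Fin N) (Fin N) ℂ) (b : PBond (F.P K) 0), H X b =
        ∑ t, (((((F.P K).L : ℝ) ^ (t.1.1 : ℕ) * ((((F.P K).L : ℝ))⁻¹) ^ (K - n))⁻¹ * flatH (F.P K) (K - n) D (Pi.single t 1) b : ℝ) : ℂ) • X t) ∧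
      -- the implicit ♭ chart on the `ε`-ball: (55)♭, analyticity, (49)♭, (48)♭
      (∀ A' : PBond (F.P K) 0 → Matrix (Fin N) (Fin N) ℂ, (∀ b, w 1 b * ‖A' b‖ < ε) →
        ∀ ρ' : ℝ, 0 ≤ ρ' → (∀ b, w 1 b * ‖A' b‖ ≤ ρ') → ∀ i : BondIdx D, ‖Dsel A' i‖ ≤ C₄ * ρ' ^ 2) ∧
      ContDiffOn ℂ ω Dsel {Y : PBond (F.P K) 0 → Matrix (Fin N) (Fin N) ℂ | ∀ b, w 1 b * ‖Y b‖ < ε} ∧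
      (∀ A' : PBond (F.P K) 0 → Matrix (Fin N) (Fin N) ℂ, (∀ b, w 1 b * ‖A' b‖ < ε) →
        chartLogFlat (((((F.P K).L : ℝ))⁻¹) ^ (K - n)) D (A' - H (Dsel A')) - (fderiv ℂ (chartLogFlat (((((F.P K).L : ℝ))⁻¹) ^ (K - n)) D :
        (PBond (F.P K) 0 → Matrix (Fin N) (Fin N) ℂ) → BondIdx D → Matrix (Fin N) (Fin N) ℂ) 0) (A' - H (Dsel A')) = Dsel A' ∧
        chartLogFlat (((((F.P K).L : ℝ))⁻¹) ^ (K - n)) D (A' - H (Dsel A')) = (fderiv ℂ (chartLogFlat (((((F.P K).L : ℝ))⁻¹) ^ (K - n)) D :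
        (PBond (F.P K) 0 → Matrix (Fin N) (Fin N) ℂ) → BondIdx D → Matrix (Fin N) (Fin N) ℂ) 0) A') ∧
      -- the reality of the implicit ♭ chart on Hermitian-traceless fields (dag-k0-s1-w4 CLAIM-8, threaded through C‴)
      (∀ A' : PBond (F.P K) 0 → Matrix (Fin N) (Fin N) ℂ, (∀ b, w 1 b * ‖A' b‖ < ε) → (∀ b, A' b ∈ herm0 (Fin N)) →
        (∀ i, Dsel A' i ∈ herm0 (Fin N)) ∧ ∀ b, (A' - H (Dsel A')) b ∈ herm0 (Fin N)) ∧
      -- the transposes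
      (∀ X δ, BE (Qt X) δ = B X ((fderiv ℂ (chartLogFlat (((((F.P K).L : ℝ))⁻¹) ^ (K - n)) D :
        (PBond (F.P K) 0 → Matrix (Fin N) (Fin N) ℂ) → BondIdx D → Matrix (Fin N) (Fin N) ℂ) 0) δ)) ∧
      (∀ Z X, BE Z (H X) = B (Ht Z) X) ∧
      (∀ (A' : PBond (F.P K) 0 → Matrix (Fin N) (Fin N) ℂ) X δ, BE (Dt A' X) δ = B X (fderiv ℂ Dsel A' δ)) ∧
      -- the chart, (157), the window, the (158)∕(98) row
      (∀ (x : Site (F.P K) 0) (μ : Fin (F.P K).d), e (x.shift μ) = B9SectCLatticeCarrier.shift μ (e x)) ∧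
      (∀ A' : PBond (F.P K) 0 → Matrix (Fin N) (Fin N) ℂ, (∀ b, w 1 b * ‖A' b‖ < ε) →
        (∀ (b : PBond (F.P K) 0) (ν : Fin (F.P K).d), w 2 b * ((F.P K).L : ℝ) ^ (K - n) * ‖A' ⟨b.src.shift ν, b.dir⟩ - A' b‖ < ε) →
        HasFDerivAt (fun A : PBond (F.P K) 0 → Matrix (Fin N) (Fin N) ℂ => 2⁻¹ * B (Dsel A) (((((((((F.P K).L : ℝ))⁻¹) ^ (K - n) : ℝ) : ℂ) ^ (F.P K).d) • MV) (Dsel A))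
            - B ((fderiv ℂ (chartLogFlat (((((F.P K).L : ℝ))⁻¹) ^ (K - n)) D :
        (PBond (F.P K) 0 → Matrix (Fin N) (Fin N) ℂ) → BondIdx D → Matrix (Fin N) (Fin N) ℂ) 0) A)
                (((((((((F.P K).L : ℝ))⁻¹) ^ (K - n) : ℝ) : ℂ) ^ (F.P K).d) • MV) (Dsel A))
            + V0 (LatticeFieldCalculus.shiftEquiv (P := F.P K) (j := 0)) (fun _ _ => (1 : (Matrix (Fin N) (Fin N) ℂ)ˣ)) ((((F.P K).L : ℝ)⁻¹) ^ (K - n)) (F.P K).d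
                (τ : Matrix (Fin N) (Fin N) ℂ →ₗ[ℂ] ℂ) (fun μ x => (A - H (Dsel A)) ⟨x, μ⟩))
          (BE (W A')) A') ∧
      DifferentiableOn ℂ W {Y : PBond (F.P K) 0 → Matrix (Fin N) (Fin N) ℂ | (∀ b, w 1 b * ‖Y b‖ < ε) ∧
        ∀ (b : PBond (F.P K) 0) (ν : Fin (F.P K).d), w 2 b * ((F.P K).L : ℝ) ^ (K - n) * ‖Y ⟨b.src.shift ν, b.dir⟩ - Y b‖ < ε} ∧
      (∀ (Y : PBond (F.P K) 0 → Matrix (Fin N) (Fin N) ℂ) (r : ℝ), r < ε → (∀ b, w 1 b * ‖Y b‖ ≤ r) →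
        (∀ (b : PBond (F.P K) 0) (ν : Fin (F.P K).d), w 2 b * ((F.P K).L : ℝ) ^ (K - n) * ‖Y ⟨b.src.shift ν, b.dir⟩ - Y b‖ ≤ r) →
        ∀ b, w 3 b * ‖W Y b‖ ≤ C₄ * r ^ 2) ∧
      -- ★ THE ♭ (127) SOCKET: small Hermitian-traceless base points whose charted configuration is critical on the record's fibre, kernel directions
      (∀ (A₁ δ : PBond (F.P K) 0 → Matrix (Fin N) (Fin N) ℂ), (∀ b, w 1 b * ‖A₁ b‖ < ε) →
        (∀ (b : PBond (F.P K) 0) (ν : Fin (F.P K).d), w 2 b * ((F.P K).L : ℝ) ^ (K - n) * ‖A₁ ⟨b.src.shift ν, b.dir⟩ - A₁ b‖ < ε) →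
        (∀ b, A₁ b ∈ herm0 (Fin N)) → (∀ b, δ b ∈ herm0 (Fin N)) →
        (fderiv ℂ (chartLogFlat (((((F.P K).L : ℝ))⁻¹) ^ (K - n)) D :
          (PBond (F.P K) 0 → Matrix (Fin N) (Fin N) ℂ) → BondIdx D → Matrix (Fin N) (Fin N) ℂ) 0) δ = 0 →
        ∀ (𝔹 : DetSet (F.P K)), (∀ (j : ℕ) (b : PBond (F.P K) j), b ∈ bondsOf (𝔹 j) → j ≤ K - n ∧ D.LamBond j b) →
        ∀ (U₁ : GaugeField (F.P K) 0 (SU N)),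
          (∀ b, ((U₁ b : SU N) : Matrix (Fin N) (Fin N) ℂ) = ((expCfg ((((F.P K).L : ℝ)⁻¹) ^ (K - n)) (A₁ - H (Dsel A₁)) b : (Matrix (Fin N) (Fin N) ℂ)ˣ) : _)) →
          IsCritOnFibre F N K 𝔹 (avgFamily (avOfRecord F N K) U₁) U₁ →
        ∀ (X₁ δX : TangentBondSU (F.P K) 0 N),
          (∀ b, ((X₁ b : lieSU (Fin N)) : Matrix (Fin N) (Fin N) ℂ) = (Complex.I * (((((F.P K).L : ℝ)⁻¹) ^ (K - n) : ℝ) : ℂ)) • A₁ b) →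
          (∀ b, ((δX b : lieSU (Fin N)) : Matrix (Fin N) (Fin N) ℂ) = (Complex.I * (((((F.P K).L : ℝ)⁻¹) ^ (K - n) : ℝ) : ℂ)) • δ b) →
          ⟪δX, hessOpAt ((((F.P K).L : ℝ)⁻¹) ^ (K - n)) (1 : GaugeField (F.P K) 0 (SU N)) X₁⟫_ℝ + (BE (W A₁) δ).re = 0) := by
  obtain ⟨Mh₀, R₀, ε, C₄, hε, hC₄, hmain⟩ := exists_sectF_W_flatScaled_atRecord_herm0 N F
  obtain ⟨Mh₁, R₁, Bf, hBf, hrows⟩ := rescaledRows_of_adm22_T4 F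
  have hL1 : (1 : ℝ) ≤ F.L := by exact_mod_cast F.hL.2.le
  have hL0 : (0 : ℝ) < (F.L : ℝ) := by linarith
  -- dag-k0-s1-w1's radius, a function of `L` and `N`
  obtain ⟨ℓr, hℓr⟩ : ∃ ℓr : ℝ, ℓr = ((((4 : ℕ) + 2) * F.L : ℕ) : ℝ) := ⟨_, rfl⟩
  have hℓ1 : (1 : ℝ) ≤ ℓr := by
    rw [hℓr]; exact_mod_cast Nat.one_le_iff_ne_zero.mpr (Nat.mul_ne_zero (by omega) (by have := F.hL.2; omega))
  have hδN : 0 < deltaSU (Fin N) := deltaSU_pos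
  obtain ⟨R, hRdef⟩ : ∃ R : ℝ, R = min (1 / (60800 * ℓr ^ 2 * (F.L : ℝ))) (deltaSU (Fin N) / (120 * ℓr ^ 2 * (F.L : ℝ))) := ⟨_, rfl⟩
  have hR0 : 0 < R := by rw [hRdef]; exact lt_min (by positivity) (by positivity)
  have hRL : 60800 * ℓr ^ 2 * (F.L : ℝ) * R ≤ 1 := by
    have h : R ≤ 1 / (60800 * ℓr ^ 2 * (F.L : ℝ)) := by rw [hRdef]; exact min_le_left _ _
    rw [le_div_iff₀ (by positivity)] at h
    linarith
  have hguard : 60 * ℓr ^ 2 * (F.L : ℝ) * R < deltaSU (Fin N) := by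
    have h : R ≤ deltaSU (Fin N) / (120 * ℓr ^ 2 * (F.L : ℝ)) := by rw [hRdef]; exact min_le_right _ _
    rw [le_div_iff₀ (by positivity)] at h
    nlinarith
  -- the radius of this file: inside D‴'s, at most `1`, and small against `R`
  have hBC : 0 < 1 + Bf * C₄ := by have := mul_nonneg hBf hC₄; linarith
  obtain ⟨ε', hε'def⟩ : ∃ ε' : ℝ, ε' = min ε (min 1 (R / (2 * (1 + Bf * C₄)))) := ⟨_, rfl⟩
  have hε'pos : 0 < ε' := by rw [hε'def]; exact lt_min hε (lt_min one_pos (by positivity))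
  have hε'le : ε' ≤ ε := by rw [hε'def]; exact min_le_left _ _
  have hε'1 : ε' ≤ 1 := by rw [hε'def]; exact (min_le_right _ _).trans (min_le_left _ _)
  have hε'R : ε' + Bf * C₄ * ε' ^ 2 ≤ R := by
    have h1 : ε' ≤ R / (2 * (1 + Bf * C₄)) := by rw [hε'def]; exact (min_le_right _ _).trans (min_le_right _ _)
    rw [le_div_iff₀ (by positivity)] at h1
    have h2 : ε' ^ 2 ≤ ε' := by nlinarith
    nlinarith [mul_nonneg hBf hC₄, mul_le_mul_of_nonneg_left h2 (mul_nonneg hBf hC₄)]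
  refine ⟨max Mh₀ Mh₁, max (max R₀ R₁) 2, ε', C₄, hε'pos, hC₄, ?_⟩
  intro n K hk1 hk' Mh R' a' hMha hMh hR' hsize D hDk hAdm w hw
  have hMh₀ : Mh₀ ≤ Mh := le_trans (le_max_left _ _) hMh
  have hMh₁ : Mh₁ ≤ Mh := le_trans (le_max_right _ _) hMh
  have hR₀ : R₀ ≤ R' := le_trans (le_trans (le_max_left _ _) (le_max_left _ _)) hR'
  have hR₁ : R₁ ≤ R' := le_trans (le_trans (le_max_right _ _) (le_max_left _ _)) hR'
  have hR2 : 2 ≤ R' := le_trans (le_max_right _ _) hR'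
  obtain ⟨τ, ρ, BE, B, hc, hwa, MV, H, Dsel, Qt, Ht, Dt, e, W, hntr, hρ, hBE, hB, hMV, hH, h55, hcd, hfix, hherm, hQt, hHt, hDt, he, h157, hdiff, h158⟩ :=
    hmain n K hk1 hk' hMha hMh₀ hR₀ hsize D hDk hAdm hw
  -- the row of `H♭` (dag-k0-s1-w4)
  have hν : ∀ t : BondIdx D, |(((F.P K).L : ℝ) ^ (t.1.1 : ℕ) * ((((F.P K).L : ℝ))⁻¹) ^ (K - n))⁻¹| ≤
      (((F.P K).L : ℝ) ^ (t.1.1 : ℕ) * ((((F.P K).L : ℝ))⁻¹) ^ (K - n))⁻¹ := fun t => by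
    have : (0 : ℝ) < ((F.P K).L : ℝ) := by exact_mod_cast (F.P K).L_pos
    rw [abs_of_pos (by positivity)]
  obtain ⟨hHB, -⟩ := hrows n K hk1 hk' hMha hMh₁ hR₁ hsize D hDk hAdm w hw (𝔸 := Matrix (Fin N) (Fin N) ℂ)
    (fun t => (((F.P K).L : ℝ) ^ (t.1.1 : ℕ) * ((((F.P K).L : ℝ))⁻¹) ^ (K - n))⁻¹) hν (fun X => H X) hH
  -- the collar of the family
  have hMh1 : 1 ≤ Mh := by rw [hMha]; exact Nat.one_le_pow _ _ (F.P K).L_pos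
  have hRM : 2 * (F.P K).L ≤ R' * (F.L * Mh) + 1 := by
    have hPL : (F.P K).L = F.L := rfl
    rw [hPL]
    calc 2 * F.L ≤ R' * (F.L * 1) := by rw [mul_one]; exact Nat.mul_le_mul_right _ hR2
      _ ≤ R' * (F.L * Mh) := Nat.mul_le_mul_left _ (Nat.mul_le_mul_left _ hMh1)
      _ ≤ R' * (F.L * Mh) + 1 := Nat.le_succ _
  have hcollar := collar_of_adm22 D hAdm hRM
  -- the budgets in the record's letters
  have hRL' : 60800 * ((((F.P K).d + 2) * (F.P K).L : ℕ) : ℝ) ^ 2 * ((F.P K).L : ℝ) * R ≤ 1 := by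
    rw [hℓr] at hRL; simpa only [T4Family.P_L, T4Family.P_d] using hRL
  have hguard' : 60 * ((((F.P K).d + 2) * (F.P K).L : ℕ) : ℝ) ^ 2 * ((F.P K).L : ℝ) * R < deltaSU (Fin N) := by
    rw [hℓr] at hguard; simpa only [T4Family.P_L, T4Family.P_d] using hguard
  -- D‴'s letters on the smaller radius
  have h55' : ∀ A' : PBond (F.P K) 0 → Matrix (Fin N) (Fin N) ℂ, (∀ b, w 1 b * ‖A' b‖ < ε') →
      ∀ ρ' : ℝ, 0 ≤ ρ' → (∀ b, w 1 b * ‖A' b‖ ≤ ρ') → ∀ i : BondIdx D, ‖Dsel A' i‖ ≤ C₄ * ρ' ^ 2 :=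
    fun A' hA' ρ' hρ' hle i => h55 A' (fun b => (hA' b).trans_le hε'le) ρ' hρ' hle i
  have hcd' : ContDiffOn ℂ ω Dsel {Y : PBond (F.P K) 0 → Matrix (Fin N) (Fin N) ℂ | ∀ b, w 1 b * ‖Y b‖ < ε'} :=
    hcd.mono fun Y hY b => (hY b).trans_le hε'le
  have hfix' : ∀ A' : PBond (F.P K) 0 → Matrix (Fin N) (Fin N) ℂ, (∀ b, w 1 b * ‖A' b‖ < ε') →
      chartLogFlat (((((F.P K).L : ℝ))⁻¹) ^ (K - n)) D (A' - H (Dsel A')) - (fderiv ℂ (chartLogFlat (((((F.P K).L : ℝ))⁻¹) ^ (K - n)) D :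
        (PBond (F.P K) 0 → Matrix (Fin N) (Fin N) ℂ) → BondIdx D → Matrix (Fin N) (Fin N) ℂ) 0) (A' - H (Dsel A')) = Dsel A' ∧
      chartLogFlat (((((F.P K).L : ℝ))⁻¹) ^ (K - n)) D (A' - H (Dsel A')) = (fderiv ℂ (chartLogFlat (((((F.P K).L : ℝ))⁻¹) ^ (K - n)) D :
        (PBond (F.P K) 0 → Matrix (Fin N) (Fin N) ℂ) → BondIdx D → Matrix (Fin N) (Fin N) ℂ) 0) A' :=
    fun A' hA' => hfix A' fun b => (hA' b).trans_le hε'le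
  have hherm' : ∀ A' : PBond (F.P K) 0 → Matrix (Fin N) (Fin N) ℂ, (∀ b, w 1 b * ‖A' b‖ < ε') → (∀ b, A' b ∈ herm0 (Fin N)) →
      (∀ i, Dsel A' i ∈ herm0 (Fin N)) ∧ ∀ b, (A' - H (Dsel A')) b ∈ herm0 (Fin N) :=
    fun A' hA' hA'h => hherm A' (fun b => (hA' b).trans_le hε'le) hA'h
  refine ⟨τ, ρ, BE, B, hc, hwa, MV, H, Dsel, Qt, Ht, Dt, e, W, hntr, hρ, hBE, hB, hMV, hH, h55', hcd', hfix', hherm', hQt, hHt, hDt, he,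
    fun A' hA' hA'2 => h157 A' (fun b => (hA' b).trans_le hε'le) (fun b ν => (hA'2 b ν).trans_le hε'le),
    hdiff.mono fun Y hY => ⟨fun b => (hY.1 b).trans_le hε'le, fun b ν => (hY.2 b ν).trans_le hε'le⟩,
    fun Y r hr h1 h2 b => h158 Y r (hr.trans_le hε'le) h1 h2 b, ?_⟩
  -- the socket
  intro A₁ δ hA₁ hA₁2 hA₁h hδh hδQ 𝔹 h𝔹 U₁ hU₁ hcrit X₁ δX hX₁ hδX
  exact socket127_flat_of_letters F N K (K - n) D hDk hcollar hw hc hwa τ hntr B hB MV hMV H hH hBf hHB Dsel hε'pos hC₄ h55' hcd'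
    (fun A' hA' => (hfix' A' hA').2) hherm' hRL' hguard' hε'R A₁ δ hA₁ hA₁h hδh hδQ
    (h157 A₁ (fun b => (hA₁ b).trans_le hε'le) (fun b ν => (hA₁2 b ν).trans_le hε'le)) 𝔹 h𝔹 U₁ hU₁ hcrit X₁ δX hX₁ hδX

end Summit.QuantumFields.YangMills.Theorems.K0Stub1SocketFlatAtRecordExists

end
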